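import Summits.BirchSwinnertonDyer.BirchSwinnertonDyer.Theorems.ShaPrimaryTransferFiniteShaComponentTransferAdmissibleDoor
import Summits.BirchSwinnertonDyer.BirchSwinnertonDyer.Theorems.ShaPrimaryTransferFiniteShaComponentTransferRowAtFiveClassWide
import Summits.BirchSwinnertonDyer.BirchSwinnertonDyer.Theorems.ShaPrimaryTransferFiniteShaComponentTransferRowAtSevenClassWide
import Literature.NumberTheory.EllipticCurves.KubertTate1718ShaFive
import Literature.NumberTheory.EllipticCurves.KubertTate2623ShaFive
import Literature.NumberTheory.EllipticCurves.KubertTate289ShaFive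
import Literature.NumberTheory.EllipticCurves.KubertTate15239ShaFive
import Literature.NumberTheory.EllipticCurves.KubertTate8687ShaFive
import Literature.NumberTheory.EllipticCurves.KubertTate34421ShaFive
import Literature.NumberTheory.EllipticCurves.KubertTate16883ShaFive
import Literature.NumberTheory.EllipticCurves.KubertTate13613ShaFive
import Literature.NumberTheory.EllipticCurves.SelmerCorankIsogenyProofs
import Literature.NumberTheory.EllipticCurves.IsogenyMordellWeilRankProofs
import Literature.NumberTheory.EllipticCurves.ComplexMultiplicationLFunctionIsogenyHoldsProofs
import Summits.BirchSwinnertonDyer.BirchSwinnertonDyer.Theorems.ShaPrimaryTransferFiniteShaComponentTransferDoorAtFiveFamily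
import Summits.BirchSwinnertonDyer.BirchSwinnertonDyer.Theorems.ShaPrimaryTransferFiniteShaComponentTransferDoorAtSeven
import Literature.NumberTheory.EllipticCurves.KubertTate1314ShaFive
import HarnessLib

/-!
# The transfer is idle on the Kubert–Tate `5`-torsion family: `r_an = rank` from X2 + X3 + Kato for every tame
# coprime `E_{m,n}` with an open door at `5`; instances — three rank-`2` and four RANK-`3` curves

Helper for item **stmt-BirchSwinnertonDyer-22356** (`FiniteShaComponentTransfer`, «T») of route
`ShaPrimaryTransfer`; closes nothing by itself; **BSD is NOT proved by this file**. Sequel of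
`…RowAtFiveClassWide` (the door prime `5` is good ordinary class-wide on `kubertTateFive m n`, `m, n` coprime,
`5 ∤ Δ`) and `…AdmissibleDoor` (§0 there: ONE X2-admissible open door + X2 + X3 + Kato ⟹ `r_an = rank`, no `T`):

* §0 `analyticRank_eq_mordellWeilRank_of_isIsogenous_addOrderOf_eq_prime` — the idle class is CLOSED UNDER
  `ℚ`-ISOGENY: if `W ~ W'` over `ℚ`, `W'` has a rational point of prime order `p ≥ 5` and good reduction at `p`, and
  `t_p(W) = 0`, then X2 + X3 + Kato give `r_an(W) = rank W(ℚ)` (`t_p`, `r_an`, rank are isogeny invariants: tree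
  `IsIsogenous.shaCorank_eq`, `analyticRank_eq_of_isIsogenous'`, `IsIsogenous.mordellWeilRank_eq`) — e.g. the
  `μ₅`-side curves `E'_{m,n} = E_{m,n}/⟨T⟩` of `KubertTateFiveVeluIsogeny`, which carry no rational `5`-torsion.
* §1 `analyticRank_eq_mordellWeilRank_of_items` — for every tame coprime `E_{m,n}` with `t₅(E_{m,n}) = 0`:
  `r_an(E_{m,n}) = rank E_{m,n}(ℚ)` granting X2 + X3 + Kato (no transfer, no `O`).
* Instances with `t₅ = 0` UNCONDITIONAL in the tree (the `μ₅`-descent box, files `KubertTate…ShaFive`): under X2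
  ALONE (leg 1 at the door prime), `r_an ≤ 2 = rank` for `E_{17/18}`, `E_{26/23}`, `E_{28/9}` and
  **`r_an ≤ 3 = rank` for the RANK-3 curves `E_{−152/39}`, `E_{−86/87}`, `E_{−344/21}`, `E_{168/83}`**; under
  X2 + X3 + Kato, `r_an(E_{−152/39}) = 3` and, on the `7`-torsion side, `r_an(E_{−8/5}) = 2`
  (`KubertTateM85Descent`, door prime `7`, `…RowAtSevenClassWide.goodOrdinary_seven`).

* §3 (appended) CLASS-WIDE UNDER X2 on the tame family (`5 ∤ Δ`, no bad prime `≡ 1 (mod 5)`, a good prime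
  `q ∈ {2,3,7,11}`, rank `≥ 1`): **`r_an(E_{m,n}) + 1 ≤ ω(mn)`** (`analyticRank_succ_le_card_primeFactors_of_X2`: X2 at
  the door prime + the unconditional descent bound `rank + t₅ + 1 ≤ ω(mn)` of `…DoorAtFiveFamily`) — a falsifiable
  family of predictions of X2; leg 2 alone `rank ≤ r_an` (`mordellWeilRank_le_analyticRank_of_X3_of_kato`, any
  globally minimal curve); hence `r_an = rank` whenever the rank attains `ω(mn) − 1` (`…_of_items_of_card_le`).
* §4 (appended) the same at `7`: `r_an(E_{m,n}) + 1 ≤ ω(mn(m−n))` on the tame Kubert–Tate `7`-torsion family under X2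
  (`analyticRank_succ_le_card_primeFactors_of_X2_seven`; door bound `…DoorAtSeven.rank_add_shaCorank_seven_succ_le`).
* §5 (appended) a curve WITHOUT rational `5`-torsion where `T` is idle: the `μ₅`-side curve `E'_{13/14}` (isogeny closure
  §0 + `KubertTate1314Descent`): `r_an(E') = rank E'(ℚ)` under X2 + X3 + Kato (`analyticRank_dual1314_eq_of_items`).
* §6 (appended, g32) the third census member with an unconditional door at `5`: `E_{136/13}` ≅ `495482o1`
  (`KubertTate13613Descent`): `r_an ≤ 2 = rank` under X2 alone, `r_an = 2` under X2 + X3 + Kato (`analyticRank_13613_*`).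

## References

* [GreenbergLNM1716] R. Greenberg, *Iwasawa theory for elliptic curves*, LNM 1716, §1 (pp. 54–57).
* [Kato2004Asterisque] K. Kato, Astérisque 295 (2004), Thm. 17.4.
* [Fisher2001FiveSevenDescent] T. Fisher, JEMS 3 (2001), §§1–2.
* [Kubert1976] D. S. Kubert, Proc. London Math. Soc. (3) 33 (1976), Table 3 (`N = 5, 7`).
-/

noncomputable section

-- D-0017: single-problem summit, so `Summit.BirchSwinnertonDyer.BirchSwinnertonDyer.…` repeats a namespace BY DESIGN.
set_option linter.dupNamespace false
set_option autoImplicit false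

open WeierstrassCurve
open Literature.NumberTheory.EllipticCurves
open Summit.BirchSwinnertonDyer.BirchSwinnertonDyer.Theses.ShaPrimaryTransfer
open Summit.BirchSwinnertonDyer.BirchSwinnertonDyer.Rank1Residual
open Summit.BirchSwinnertonDyer.BirchSwinnertonDyer.Theorems.ShaPrimaryTransferRowAtFiveClassWide
open Summit.BirchSwinnertonDyer.BirchSwinnertonDyer.Theorems.ShaPrimaryTransferAdmissibleDoor

namespace Summit.BirchSwinnertonDyer.BirchSwinnertonDyer.Theorems.ShaPrimaryTransferRowAtFiveTransferIdle

/-! ## §0 The idle class is closed under `ℚ`-isogeny -/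

/-- **Closed under isogeny**: for `ℚ`-isogenous elliptic `W ~ W'` with `W'` carrying a rational point of prime
order `p ≥ 5` and good reduction at `p`, an open door `t_p(W) = 0` gives `r_an(W) = rank W(ℚ)` from X2 + X3 +
Kato — no transfer (`t_p`, `ord_{s=1} L` and the rank are `ℚ`-isogeny invariants; `…AdmissibleDoor` §1 on `W'`).
CONDITIONAL on `hX2`, `hX3`, `hK`. [cite: GreenbergLNM1716, §1 (pp. 54–57)] [cite: Kato2004Asterisque, Thm. 17.4] -/
theorem analyticRank_eq_mordellWeilRank_of_isIsogenous_addOrderOf_eq_prime (hX2 : AnalyticRankLeSelmerCorank)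
    (hX3 : PadicOrderLeAnalyticRankAtOnePrime) (hK : KatoRankBound)
    (W W' : WeierstrassCurve ℚ) [W.IsElliptic] [W'.IsElliptic] (h : IsIsogenous W W')
    (p : ℕ) [Fact p.Prime] (h5 : 5 ≤ p) (P : W'.toAffine.Point) (hP : addOrderOf P = p)
    (hgood : W'.HasGoodReductionAtPrime p) (ht : W.shaCorank p = 0) :
    W.analyticRank = W.mordellWeilRank := by
  have ht' : W'.shaCorank p = 0 := by rw [← h.shaCorank_eq p]; exact ht
  rw [analyticRank_eq_of_isIsogenous' h, h.mordellWeilRank_eq]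
  exact analyticRank_eq_mordellWeilRank_of_addOrderOf_eq_prime' hX2 hX3 hK W' p h5 P hP hgood ht'

/-! ## §1 The Kubert–Tate `5`-torsion family with an open door at `5`; instances -/

/-- **X2 + X3 + Kato + an open door at `5` give `r_an(E_{m,n}) = rank E_{m,n}(ℚ)`** for every tame coprime `E_{m,n}`
with `t₅ = 0` — the route's assembly WITHOUT `T` and without `O` (§0 at `p₀ = 5`). CONDITIONAL on `hX2`, `hX3`, `hK`.
[cite: GreenbergLNM1716, §1 (pp. 54–57)] [cite: Kato2004Asterisque, Thm. 17.4] -/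
theorem analyticRank_eq_mordellWeilRank_of_items (hX2 : AnalyticRankLeSelmerCorank)
    (hX3 : PadicOrderLeAnalyticRankAtOnePrime) (hK : KatoRankBound) (m n : ℤ)
    [(kubertTateFive (m : ℚ) (n : ℚ)).IsElliptic] (hcop : IsCoprime m n)
    (h5 : ¬ (5 : ℤ) ∣ (kubertTateFive m n).Δ) (ht : (kubertTateFive (m : ℚ) (n : ℚ)).shaCorank 5 = 0) :
    (kubertTateFive (m : ℚ) (n : ℚ)).analyticRank = (kubertTateFive (m : ℚ) (n : ℚ)).mordellWeilRank := by
  haveI := isGloballyMinimal_kubertTateFive_of_isCoprime m n hcop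
  have hgo := goodOrdinary_five m n hcop h5
  exact analyticRank_eq_mordellWeilRank_of_admissibleDoor hX2 hX3 hK _ 5 le_rfl hgo.1 hgo.2 ht

/-- **`r_an(E_{17/18}) ≤ 2 = rank`** from X2 alone (`t₅ = 0` by the `μ₅`-descent, tree `KubertTate1718Descent`).
[cite: GreenbergLNM1716, §1 (pp. 54–57)] [cite: Fisher2001FiveSevenDescent, §2] -/
theorem analyticRank_1718_le_two_of_X2 (hX2 : AnalyticRankLeSelmerCorank) :
    haveI := KubertTate1718Descent.isElliptic
    (kubertTateFive (((17 : ℤ) : ℚ)) (((18 : ℤ) : ℚ))).analyticRank ≤ 2 := by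
  haveI := KubertTate1718Descent.isElliptic
  have h := analyticRank_le_mordellWeilRank_of_X2 hX2 17 18 (Int.isCoprime_iff_gcd_eq_one.mpr (by decide))
    KubertTate1718Descent.not_five_dvd_Δ KubertTate1718Descent.shaCorank_five_eq_zero
  rwa [KubertTate1718Descent.mordellWeilRank_eq] at h

/-- **`r_an(E_{26/23}) ≤ 2 = rank`** from X2 alone. [cite: GreenbergLNM1716, §1 (pp. 54–57)] [cite: Fisher2001FiveSevenDescent, §2] -/
theorem analyticRank_2623_le_two_of_X2 (hX2 : AnalyticRankLeSelmerCorank) :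
    haveI := KubertTate2623Descent.isElliptic
    (kubertTateFive (((26 : ℤ) : ℚ)) (((23 : ℤ) : ℚ))).analyticRank ≤ 2 := by
  haveI := KubertTate2623Descent.isElliptic
  have h := analyticRank_le_mordellWeilRank_of_X2 hX2 26 23 (Int.isCoprime_iff_gcd_eq_one.mpr (by decide))
    KubertTate2623Descent.not_five_dvd_Δ KubertTate2623Descent.shaCorank_five_eq_zero
  rwa [KubertTate2623Descent.mordellWeilRank_eq] at h

/-- **`r_an(E_{28/9}) ≤ 2 = rank`** from X2 alone. [cite: GreenbergLNM1716, §1 (pp. 54–57)] [cite: Fisher2001FiveSevenDescent, §2] -/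
theorem analyticRank_289_le_two_of_X2 (hX2 : AnalyticRankLeSelmerCorank) :
    haveI := KubertTate289Descent.isElliptic
    (kubertTateFive (((28 : ℤ) : ℚ)) (((9 : ℤ) : ℚ))).analyticRank ≤ 2 := by
  haveI := KubertTate289Descent.isElliptic
  have h := analyticRank_le_mordellWeilRank_of_X2 hX2 28 9 (Int.isCoprime_iff_gcd_eq_one.mpr (by decide))
    KubertTate289Descent.not_five_dvd_Δ KubertTate289Descent.shaCorank_five_eq_zero
  rwa [KubertTate289Descent.mordellWeilRank_eq] at h

/-- **`r_an(E_{−152/39}) ≤ 3 = rank`** from X2 alone — a RANK-3 curve (`t₅ = 0` by the `μ₅`-descent, tree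
`KubertTate15239Descent`). [cite: GreenbergLNM1716, §1 (pp. 54–57)] [cite: Fisher2001FiveSevenDescent, §2] -/
theorem analyticRank_15239_le_three_of_X2 (hX2 : AnalyticRankLeSelmerCorank) :
    haveI := KubertTate15239Descent.isElliptic
    (kubertTateFive (((-152 : ℤ) : ℚ)) (((39 : ℤ) : ℚ))).analyticRank ≤ 3 := by
  haveI := KubertTate15239Descent.isElliptic
  have h := analyticRank_le_mordellWeilRank_of_X2 hX2 (-152) 39 (Int.isCoprime_iff_gcd_eq_one.mpr (by decide))
    KubertTate15239Descent.not_five_dvd_Δ KubertTate15239Descent.shaCorank_five_eq_zero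
  rwa [KubertTate15239Descent.mordellWeilRank_eq] at h

/-- **`r_an(E_{−86/87}) ≤ 3 = rank`** from X2 alone (rank 3). [cite: GreenbergLNM1716, §1 (pp. 54–57)] [cite: Fisher2001FiveSevenDescent, §2] -/
theorem analyticRank_8687_le_three_of_X2 (hX2 : AnalyticRankLeSelmerCorank) :
    haveI := KubertTate8687Descent.isElliptic
    (kubertTateFive (((-86 : ℤ) : ℚ)) (((87 : ℤ) : ℚ))).analyticRank ≤ 3 := by
  haveI := KubertTate8687Descent.isElliptic
  have h := analyticRank_le_mordellWeilRank_of_X2 hX2 (-86) 87 (Int.isCoprime_iff_gcd_eq_one.mpr (by decide))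
    KubertTate8687Descent.not_five_dvd_Δ KubertTate8687Descent.shaCorank_five_eq_zero
  rwa [KubertTate8687Descent.mordellWeilRank_eq] at h

/-- **`r_an(E_{−344/21}) ≤ 3 = rank`** from X2 alone (rank 3). [cite: GreenbergLNM1716, §1 (pp. 54–57)] [cite: Fisher2001FiveSevenDescent, §2] -/
theorem analyticRank_34421_le_three_of_X2 (hX2 : AnalyticRankLeSelmerCorank) :
    haveI := KubertTate34421Descent.isElliptic
    (kubertTateFive (((-344 : ℤ) : ℚ)) (((21 : ℤ) : ℚ))).analyticRank ≤ 3 := by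
  haveI := KubertTate34421Descent.isElliptic
  have h := analyticRank_le_mordellWeilRank_of_X2 hX2 (-344) 21 (Int.isCoprime_iff_gcd_eq_one.mpr (by decide))
    KubertTate34421Descent.not_five_dvd_Δ KubertTate34421Descent.shaCorank_five_eq_zero
  rwa [KubertTate34421Descent.mordellWeilRank_eq] at h

/-- **`r_an(E_{168/83}) ≤ 3 = rank`** from X2 alone (rank 3). [cite: GreenbergLNM1716, §1 (pp. 54–57)] [cite: Fisher2001FiveSevenDescent, §2] -/
theorem analyticRank_16883_le_three_of_X2 (hX2 : AnalyticRankLeSelmerCorank) :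
    haveI := KubertTate16883Descent.isElliptic
    (kubertTateFive (((168 : ℤ) : ℚ)) (((83 : ℤ) : ℚ))).analyticRank ≤ 3 := by
  haveI := KubertTate16883Descent.isElliptic
  have h := analyticRank_le_mordellWeilRank_of_X2 hX2 168 83 (Int.isCoprime_iff_gcd_eq_one.mpr (by decide))
    KubertTate16883Descent.not_five_dvd_Δ KubertTate16883Descent.shaCorank_five_eq_zero
  rwa [KubertTate16883Descent.mordellWeilRank_eq] at h

/-- **`r_an(E_{−152/39}) = 3`** granting X2 + X3 + Kato — rank-BSD for a rank-`3` curve from the route's items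
WITHOUT the transfer. CONDITIONAL on `hX2`, `hX3`, `hK`. [cite: GreenbergLNM1716, §1 (pp. 54–57)] [cite: Kato2004Asterisque, Thm. 17.4] -/
theorem analyticRank_15239_eq_three_of_items (hX2 : AnalyticRankLeSelmerCorank)
    (hX3 : PadicOrderLeAnalyticRankAtOnePrime) (hK : KatoRankBound) :
    haveI := KubertTate15239Descent.isElliptic
    (kubertTateFive (((-152 : ℤ) : ℚ)) (((39 : ℤ) : ℚ))).analyticRank = 3 := by
  haveI := KubertTate15239Descent.isElliptic
  have h := analyticRank_eq_mordellWeilRank_of_items hX2 hX3 hK (-152) 39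
    (Int.isCoprime_iff_gcd_eq_one.mpr (by decide)) KubertTate15239Descent.not_five_dvd_Δ
    KubertTate15239Descent.shaCorank_five_eq_zero
  rwa [KubertTate15239Descent.mordellWeilRank_eq] at h

/-! ## §2 The `7`-torsion side: `E_{−8/5}` -/

/-- **`r_an(E_{−8/5}) = 2`** for the Kubert–Tate `7`-torsion curve `E_{−8/5}` granting X2 + X3 + Kato (door prime `7`,
`t₇ = 0` by the `μ₇`-descent, tree `KubertTateM85Descent`; no transfer). CONDITIONAL on `hX2`, `hX3`, `hK`.
[cite: GreenbergLNM1716, §1 (pp. 54–57)] [cite: Kato2004Asterisque, Thm. 17.4] -/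
theorem analyticRank_M85_eq_two_of_items (hX2 : AnalyticRankLeSelmerCorank)
    (hX3 : PadicOrderLeAnalyticRankAtOnePrime) (hK : KatoRankBound) :
    haveI := KubertTateM85Descent.isElliptic
    (kubertTateSeven (((-8 : ℤ) : ℚ)) (((5 : ℤ) : ℚ))).analyticRank = 2 := by
  haveI := KubertTateM85Descent.isElliptic
  have hcop : IsCoprime (-8 : ℤ) 5 := Int.isCoprime_iff_gcd_eq_one.mpr (by decide)
  haveI := isGloballyMinimal_kubertTateSeven (-8) 5 hcop KubertTateM85Descent.not_seven_dvd_Δ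
  have hgo := ShaPrimaryTransferRowAtSevenClassWide.goodOrdinary_seven (-8) 5 hcop KubertTateM85Descent.not_seven_dvd_Δ
  have h := analyticRank_eq_mordellWeilRank_of_admissibleDoor hX2 hX3 hK _ 7 (by norm_num) hgo.1 hgo.2
    KubertTateM85Descent.shaCorank_seven_eq_zero
  rwa [KubertTateM85Descent.mordellWeilRank_eq] at h

/-! ## §3 Class-wide under X2 on the tame family: `r_an(E_{m,n}) + 1 ≤ ω(mn)`; leg 2 alone: `rank ≤ r_an` -/

/-- **Leg 2 of the assembly alone: `rank E(ℚ) ≤ ord_{s=1} L(E, s)` for every globally minimal elliptic `E/ℚ`,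
granting X3 and the Kato side** (no `Ш`, no X2, no door: `rank ≤ ord_T L_p(f, α_p, T) ≤ r_an` at the prime of X3).
CONDITIONAL on `hX3`, `hK`. [cite: Kato2004Asterisque, Thm. 17.4] -/
theorem mordellWeilRank_le_analyticRank_of_X3_of_kato (hX3 : PadicOrderLeAnalyticRankAtOnePrime)
    (hK : KatoRankBound) (W : WeierstrassCurve ℚ) [W.IsElliptic] [W.IsGloballyMinimal] :
    W.mordellWeilRank ≤ W.analyticRank := by
  obtain ⟨p, hp, h5p, hgoodp, hordp, N, hN, f, hf, hle⟩ := hX3 W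
  have hp2 : p ≠ 2 := by omega
  have hordAt : IsOrdinaryAt W p := ⟨hgoodp, hordp⟩
  have hk := hK W p hp2 hordAt f hf
  exact_mod_cast hk.trans hle

/-- **X2 on the tame Kubert–Tate `5`-torsion family, class-wide: `ord_{s=1} L(E_{m,n}, s) + 1 ≤ ω(mn)`** for
`m, n` coprime, `5 ∤ Δ`, no bad prime `≡ 1 (mod 5)`, a good prime `q ∈ {2, 3, 7, 11}` and rank `≥ 1` — X2 at the
admissible door prime `5` (`r_an ≤ s₅`, `…RowAtFiveClassWide`) composed with the UNCONDITIONAL first-descent +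
Cassels–Tate bound `rank + t₅ + 1 ≤ ω(mn)` (`…DoorAtFiveFamily.rank_add_shaCorank_five_succ_le_of_rank_pos`) and the
Kummer identity `s₅ = rank + t₅`. A falsifiable family of predictions of X2 (KatoTransfer's crux, stmt-18412):
no tame member has analytic rank `≥ ω(mn)`. CONDITIONAL on `hX2` only.
[cite: GreenbergLNM1716, §1 (pp. 54–57)] [cite: Fisher2001FiveSevenDescent, §2] -/
theorem analyticRank_succ_le_card_primeFactors_of_X2 (hX2 : AnalyticRankLeSelmerCorank) (m n : ℤ)
    [(kubertTateFive (m : ℚ) (n : ℚ)).IsElliptic] (hcop : IsCoprime m n)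
    (h5 : ¬ (5 : ℤ) ∣ (kubertTateFive m n).Δ)
    (h1 : ∀ p : ℕ, p.Prime → (p : ℤ) ∣ (kubertTateFive m n).Δ → p % 5 ≠ 1)
    (q : ℕ) [Fact q.Prime] (hq5 : q ≠ 5) (hq11 : 2 * q + 1 < 25) (hq : ¬ (q : ℤ) ∣ (kubertTateFive m n).Δ)
    (hr : 1 ≤ (kubertTateFive (m : ℚ) (n : ℚ)).mordellWeilRank) :
    (kubertTateFive (m : ℚ) (n : ℚ)).analyticRank + 1 ≤ (m * n).natAbs.primeFactors.card := by
  have hX := analyticRank_le_selmerCorank_five_of_X2 hX2 m n hcop h5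
  have hid : (kubertTateFive (m : ℚ) (n : ℚ)).selmerCorank 5 =
      (kubertTateFive (m : ℚ) (n : ℚ)).mordellWeilRank + (kubertTateFive (m : ℚ) (n : ℚ)).shaCorank 5 :=
    (kubertTateFive (m : ℚ) (n : ℚ)).selmerCorank_eq_mordellWeilRank_add_holds 5
  have hD := ShaPrimaryTransferDoorAtFiveFamily.rank_add_shaCorank_five_succ_le_of_rank_pos m n h5 h1 q hq5 hq11 hq hr
  omega

/-- **… and with X3 + Kato: `rank ≤ r_an ≤ ω(mn) − 1`**, so `r_an = rank` as soon as the rank attains the descent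
bound `ω(mn) − 1` (the full-box case, where also `t₅ = 0`: `…DoorAtFiveFamily.shaCorank_five_eq_zero_of_rank`).
CONDITIONAL on `hX2`, `hX3`, `hK`. [cite: GreenbergLNM1716, §1 (pp. 54–57)] [cite: Kato2004Asterisque, Thm. 17.4] -/
theorem analyticRank_eq_mordellWeilRank_of_items_of_card_le (hX2 : AnalyticRankLeSelmerCorank)
    (hX3 : PadicOrderLeAnalyticRankAtOnePrime) (hK : KatoRankBound) (m n : ℤ)
    [(kubertTateFive (m : ℚ) (n : ℚ)).IsElliptic] (hcop : IsCoprime m n)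
    (h5 : ¬ (5 : ℤ) ∣ (kubertTateFive m n).Δ)
    (h1 : ∀ p : ℕ, p.Prime → (p : ℤ) ∣ (kubertTateFive m n).Δ → p % 5 ≠ 1)
    (q : ℕ) [Fact q.Prime] (hq5 : q ≠ 5) (hq11 : 2 * q + 1 < 25) (hq : ¬ (q : ℤ) ∣ (kubertTateFive m n).Δ)
    (hr : 1 ≤ (kubertTateFive (m : ℚ) (n : ℚ)).mordellWeilRank)
    (hω : (m * n).natAbs.primeFactors.card ≤ (kubertTateFive (m : ℚ) (n : ℚ)).mordellWeilRank + 1) :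
    (kubertTateFive (m : ℚ) (n : ℚ)).analyticRank = (kubertTateFive (m : ℚ) (n : ℚ)).mordellWeilRank := by
  haveI := isGloballyMinimal_kubertTateFive_of_isCoprime m n hcop
  have h1' := analyticRank_succ_le_card_primeFactors_of_X2 hX2 m n hcop h5 h1 q hq5 hq11 hq hr
  have h2 := mordellWeilRank_le_analyticRank_of_X3_of_kato hX3 hK (kubertTateFive (m : ℚ) (n : ℚ))
  omega


/-! ## §4 The same at `7`: class-wide under X2 on the tame Kubert–Tate `7`-torsion family, `r_an + 1 ≤ ω(mn(m−n))` -/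

/-- **X2 on the tame Kubert–Tate `7`-torsion family, class-wide: `ord_{s=1} L(E_{m,n}, s) + 1 ≤ ω(mn(m−n))`** for
`m, n` coprime, `7 ∤ Δ`, no bad prime `≡ 1 (mod 7)`, a good prime `q ≤ 23`, `q ≠ 7`, and a rational point `P₁` with
`49 P₁ ≠ O` (any point of infinite order; the binder of `…DoorAtSeven`) — X2 at the
admissible door prime `7` (`a₇ = 1`, `…RowAtSevenClassWide.analyticRank_le_selmerCorank_seven_of_X2`) composed with
the UNCONDITIONAL `μ₇`-descent + Cassels–Tate bound `rank + t₇ + 1 ≤ ω(mn(m−n))`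
(`…DoorAtSeven.rank_add_shaCorank_seven_succ_le`) and the Kummer identity. CONDITIONAL on `hX2` only.
[cite: GreenbergLNM1716, §1 (pp. 54–57)] [cite: Fisher2001FiveSevenDescent, §2] -/
theorem analyticRank_succ_le_card_primeFactors_of_X2_seven (hX2 : AnalyticRankLeSelmerCorank) (m n : ℤ)
    [(kubertTateSeven (m : ℚ) (n : ℚ)).IsElliptic] (hcop : IsCoprime m n)
    (P₁ : geomPoints (kubertTateSeven (m : ℚ) (n : ℚ)))
    (hP₁ : ∀ σ : Field.absoluteGaloisGroup ℚ, σ • P₁ = P₁) (h49 : ((49 : ℕ) : ℤ) • P₁ ≠ 0)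
    (h7 : ¬ (7 : ℤ) ∣ (kubertTateSeven m n).Δ)
    (h1 : ∀ p : ℕ, p.Prime → (p : ℤ) ∣ (kubertTateSeven m n).Δ → p % 7 ≠ 1)
    (q : ℕ) [Fact q.Prime] (hq7 : q ≠ 7) (hq23 : 2 * q + 1 < 49) (hq : ¬ (q : ℤ) ∣ (kubertTateSeven m n).Δ) :
    (kubertTateSeven (m : ℚ) (n : ℚ)).analyticRank + 1 ≤ (m * n * (m - n)).natAbs.primeFactors.card := by
  have hX := ShaPrimaryTransferRowAtSevenClassWide.analyticRank_le_selmerCorank_seven_of_X2 hX2 m n hcop h7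
  have hid : (kubertTateSeven (m : ℚ) (n : ℚ)).selmerCorank 7 =
      (kubertTateSeven (m : ℚ) (n : ℚ)).mordellWeilRank + (kubertTateSeven (m : ℚ) (n : ℚ)).shaCorank 7 :=
    (kubertTateSeven (m : ℚ) (n : ℚ)).selmerCorank_eq_mordellWeilRank_add_holds 7
  have hD := ShaPrimaryTransferDoorAtSeven.rank_add_shaCorank_seven_succ_le m n P₁ hP₁ h49 h7 h1 q hq7 hq23 hq
  omega


/-! ## §5 A curve WITHOUT rational `5`-torsion where `T` is idle: the `μ₅`-side curve `E'_{13/14} = E_{13/14}/⟨T⟩` -/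

/-- **`r_an(E'_{13/14}) = rank E'_{13/14}(ℚ)` from X2 + X3 + Kato, no transfer** — `E' = kubertTateFive' 13 14 =
[1, −182, −2548, −306670, −121427670]` is `ℚ`-isogenous (dual of Vélu's `5`-isogeny, tree `KubertTate1314Descent.exists_dual`)
to `E_{13/14}`, which carries the rational point `T` of order `5` and has good (ordinary) reduction at `5`; `t₅(E') = 0`
unconditionally (`KubertTate1314Descent.shaCorank_five_E'_eq_zero`). §0 applies. CONDITIONAL on `hX2`, `hX3`, `hK`.
[cite: GreenbergLNM1716, §1 (pp. 54–57)] [cite: Kato2004Asterisque, Thm. 17.4] -/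
theorem analyticRank_dual1314_eq_of_items (hX2 : AnalyticRankLeSelmerCorank)
    (hX3 : PadicOrderLeAnalyticRankAtOnePrime) (hK : KatoRankBound) :
    (KubertTateVelu.kubertTateFive' (13 : ℚ) 14).analyticRank =
      (KubertTateVelu.kubertTateFive' (13 : ℚ) 14).mordellWeilRank := by
  obtain ⟨ψ, -⟩ := KubertTate1314Descent.exists_dual
  have hiso : IsIsogenous (KubertTateVelu.kubertTateFive' (13 : ℚ) 14) KubertTate1314Descent.E := ⟨ψ⟩
  have hcop : IsCoprime (13 : ℤ) 14 := Int.isCoprime_iff_gcd_eq_one.mpr (by decide)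
  have h5 : ¬ (5 : ℤ) ∣ (kubertTateFive (13 : ℤ) 14).Δ := by rw [kubertTateFive_Δ]; norm_num
  have hgood : KubertTate1314Descent.E.HasGoodReductionAtPrime 5 := by
    simpa using (goodOrdinary_five 13 14 hcop h5).1
  exact analyticRank_eq_mordellWeilRank_of_isIsogenous_addOrderOf_eq_prime hX2 hX3 hK _ _ hiso 5 le_rfl
    KubertTate1314Descent.T KubertTate1314Descent.addOrderOf_T hgood KubertTate1314Descent.shaCorank_five_E'_eq_zero


/-! ## §6 (appended, g32) `E_{136/13}` ≅ census `495482o1` — the third census member with an unconditional door at `5` -/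

/-- **`r_an(E_{136/13}) ≤ 2 = rank`** from X2 alone (`t₅ = 0` and `rank = 2` by the `μ₅`-descent box, tree
`KubertTate13613Descent`; the curve is census `495482o1`, where also `t₂ = 0` by the SEL2CUBIC door —
`…CrossPrimeCellTwoFive`). [cite: GreenbergLNM1716, §1 (pp. 54–57)] [cite: Fisher2001FiveSevenDescent, §2] -/
theorem analyticRank_13613_le_two_of_X2 (hX2 : AnalyticRankLeSelmerCorank) :
    haveI := KubertTate13613Descent.isElliptic
    (kubertTateFive (((136 : ℤ) : ℚ)) (((13 : ℤ) : ℚ))).analyticRank ≤ 2 := by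
  haveI := KubertTate13613Descent.isElliptic
  have h := analyticRank_le_mordellWeilRank_of_X2 hX2 136 13 (Int.isCoprime_iff_gcd_eq_one.mpr (by decide))
    KubertTate13613Descent.not_five_dvd_Δ KubertTate13613Descent.shaCorank_five_eq_zero
  rwa [KubertTate13613Descent.mordellWeilRank_eq] at h

/-- **`r_an(E_{136/13}) = 2`** granting X2 + X3 + Kato — the route's assembly on this curve WITHOUT `T` (the door prime
`5` is admissible; no transfer from the door at `2` is needed). CONDITIONAL on `hX2`, `hX3`, `hK`.
[cite: GreenbergLNM1716, §1 (pp. 54–57)] [cite: Kato2004Asterisque, Thm. 17.4] -/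
theorem analyticRank_13613_eq_two_of_items (hX2 : AnalyticRankLeSelmerCorank)
    (hX3 : PadicOrderLeAnalyticRankAtOnePrime) (hK : KatoRankBound) :
    haveI := KubertTate13613Descent.isElliptic
    (kubertTateFive (((136 : ℤ) : ℚ)) (((13 : ℤ) : ℚ))).analyticRank = 2 := by
  haveI := KubertTate13613Descent.isElliptic
  have h := analyticRank_eq_mordellWeilRank_of_items hX2 hX3 hK 136 13
    (Int.isCoprime_iff_gcd_eq_one.mpr (by decide)) KubertTate13613Descent.not_five_dvd_Δ
    KubertTate13613Descent.shaCorank_five_eq_zero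
  rwa [KubertTate13613Descent.mordellWeilRank_eq] at h

end Summit.BirchSwinnertonDyer.BirchSwinnertonDyer.Theorems.ShaPrimaryTransferRowAtFiveTransferIdle

end
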